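/-
Copyright (c) 2026 the pub-hodgecm-mathlib formalisation cell (harness21).  Prover seat hodgecm-mathlib-K2E3-p06 (g6) (E3 hand lent to L1; LEAD F0P6-plan (g14) BATCH #106 (1);
desk K2E3-p14 (g9)), Track B «K2-LIT» ∕ hLiu418 = stmt-HodgeConjecture-24832: U1-CT-ind stage 3, brick B2a′, file W-FE-1 — the ψ-Whittaker functional equation under the
rank-one intertwining operator (group-abstract, like ★ `K2LiuRankOneOperators`, ★ `K2LiuRankOneStageTwisted`).  THEOREMS ONLY (no `def`∕`instance`∕notation∕`sorry`).
-/
import Summits.HodgeConjecture.HodgeConjecture.Theorems.K2LiuRankOneStageTwisted   -- ★ (K1a-3)-S (K2E3-p29 (g2)): `twisted_const_on_cosets`, the twisted stage as a coset sum; brings ★ B3 `K2LiuRankOneOperators`, ★ B5a `K2LiuRankOneLevelShells`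
import Summits.HodgeConjecture.HodgeConjecture.Theorems.K2LiuTwistedFarBall         -- W-FE-1a (this seat): Haar translation of a twisted ball integral, the far ball integrates to zero
import HarnessLib

/-!
# Crux `HLiu418`, organ U1-CT-ind STAGE 3 («U1-glob»), brick B2a′, file W-FE-1: THE RANK-ONE ψ-WHITTAKER FUNCTIONAL EQUATION on `1 < re e` —
# `W^ψ_σ(A_e f)(y) = Γ^M_σ(e) · W^ψ_σ(f)(y)`, `Γ^M_σ(e) = ∫_{‖x‖ ≥ ‖κ‖q^{−M}} C₀ ν(x)⁻¹‖x‖^{−e} ψ(σκ∕x) dμ` EXPLICIT [CasselmanShalika1980 §2–§4; Casselman1980 §3; KudlaRallis1994 §2]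

Cell `hodgecm-mathlib`, crux item hLiu418 = `stmt-HodgeConjecture-24832`; squad K2, strike line L1, LEAD F0P6-plan (g14); desk K2E3-p14 (g9) + K2Liu-p13 (g4);
prover K2E3-p06 (g6).  Lane `--supports stmt-HodgeConjecture-24832 --as helper` (count-neutral).  DEF-FREE and GROUP-ABSTRACT: the letters of ★ B3 `K2LiuRankOneOperators`
VERBATIM (`hfK hu_add w₀ ν e C₀ hrel y m₀ hmu hmū`), ★ (K1a-3)-S `K2LiuRankOneStageTwisted`'s twist `conj ψ(σx)` and head threshold `hσm`, plus ONE structure letter, the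
BRUHAT WORD (W) `hword : ū r · (w₀ · u x′) = w₀ · u (x′ + κ·r)` (at `U(2,2)_v`: `ū(r) = w₂ u(r) w₂`, `w₂² = 1`, `u` additive), a TAIL LETTER `T x = C₀ ν(x)⁻¹ ‖x‖^{−e}` (any
value at `0`) and a CONDUCTOR LETTER `hνc` for `ν` (trivial on the units `≡ 1 (mod 𝔭^{c_ν})`).
THE POINT (B2a′ census, Whittaker road).  U1-glob at a NON-SPLIT place needs, instead of injectivity of the centre operator `N^{(1)}(0)`, only the FUNCTIONAL EQUATION of the
ψ_σ-Whittaker functional under the rank-one operator `(A_e f)(g) := ∫ f(w₀ u(x) g) dμ(x)` (★ B3).  Mechanism: for `x ≠ 0`, `f(w₀ u(x)·w₀ u(x′) y) = T(x)·f(w₀ u(x′ + κ∕x) y)`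
((SL₂)+(W)); the ψ_σ-twisted head sum over `x′` of the TRANSLATE is `ψ(σκ∕x)` times the twisted integral over the SHIFTED ball `κ∕x + 𝔭^{−M}` (Haar) — the original ball
when `κ∕x ∈ 𝔭^{−M}`, else a FAR ball on which the tail `C₀ f(y) ν(·)⁻¹‖·‖^{−e}` does not move under a small `t₀` with `ψ(σt₀) ≠ 1` and therefore integrates to `0` against
`conj ψ(σ·)` (Tate).  Summing the finite head sum INSIDE the `x`-integral (no product Fubini):
  **`Σ_{a∈R} μ(𝔭^m) conj ψ(σa)·(A_e f)(w₀ u(a) y) = (∫_{x ∉ 𝔭^{M+k_κ+1}} T(x) ψ(σκx⁻¹) dμ) · Σ_{a∈R} μ(𝔭^m) conj ψ(σa)·f(w₀ u(a) y)`** (`‖κ‖ = q^{−k_κ}`),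
for a coset level `m ≥ m₀` past the head threshold and `M ≥ max(m₀, −j, c_ν − j − 1)` (`σ ∉ 𝔭^{c_ψ − j}`); both sides are the honest truncation-stable twisted stages
(★ (K1a-3)-S's coset sums) of `A_e f` and of `f`.  Measure theory = W-FE-1a ★∕📤 `K2LiuTwistedFarBall` (Haar translation, far ball); here the
(SL₂)-datum: `apply_weyl_u_weyl_u_eq`, `twistedHeadSum_comp_add_eq`, the FE **`twistedHeadSum_intertwined_eq_mul`**.  NOT here (sequel W-FE-2): continuation to the
centre `e(s₀) = 1` (★ F1 identity principle, `A_e = L(e−1,ν)·N_e` ★ B7-S, `Γ^M_σ = L(e−1,ν⁻¹)·Γ̃^M_σ`) and `Γ̃^M_σ(1) ≠ 0` (inert `unramValue ν = −1`; ramified: a Gauss sum);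
the instantiation at `U(2,2)_v` (discharge of (W), `T`, `hνc` over ★ B4c-1 ∕ ★ B4d-3).
References: [CasselmanShalika1980] W. Casselman, J. Shalika, Compositio Math. 41 (1980), §2–§4 (the Whittaker functional along a rank-one intertwining operator);
[Casselman1980] W. Casselman, Compositio Math. 40 (1980), §3 Thm. 3.1; [KudlaRallis1994] S. Kudla, S. Rallis, Ann. of Math. 140 (1994), §2; [GanTakeda2011SiegelWeil]
W. T. Gan, S. Takeda (2011), §7 Lemma 7.4; [Tate1950] J. Tate (1950), §2.5.
HONEST LABEL.  Count-neutral helper: `HC_CM` is proved only modulo the 7 printed citations (2 remaining named inputs: hLiu418 = `stmt-HodgeConjecture-24832`,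
h413 = `stmt-HodgeConjecture-24833`) until rung 0 closes; U1-glob OPEN; B2a′ OPEN (W-FE-2 + instantiation); this file closes no socket.
-/

set_option autoImplicit false
set_option linter.dupNamespace false -- the mandated namespace repeats `HodgeConjecture.HodgeConjecture`

noncomputable section

open MeasureTheory Filter Topology Set
open scoped NNReal ENNReal ComplexConjugate
open NumberField IsDedekindDomain
open Literature.NumberTheory.GaloisRepresentations.IsNonarchimedeanLocalField
open Literature.NumberTheory.Automorphic Literature.NumberTheory.Automorphic.LocalFieldHaar
open Summit.HodgeConjecture.HodgeConjecture.Cruxes.HLiu418.K2LiuRankOneOperators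
open Summit.HodgeConjecture.HodgeConjecture.Cruxes.HLiu418.K2LiuRankOneLevelShells (integrableOn_and_setIntegral_head_eq_sum)
open Summit.HodgeConjecture.HodgeConjecture.Cruxes.HLiu418.K2LiuRankOneStageTwisted (twisted_const_on_cosets)
open Summit.HodgeConjecture.HodgeConjecture.Cruxes.HLiu418.K2LiuTwistedFarBall

namespace Summit.HodgeConjecture.HodgeConjecture.Cruxes.HLiu418.K2LiuRankOneWhittakerFunctionalEquation

/-! ## The (SL₂)-datum: the functional equation of the twisted stage under the rank-one operator -/

section Datum

variable {K : Type} [Field K] [NumberField K] {w : HeightOneSpectrum (𝓞 K)} {G : Type*} [Group G]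

/-- **(SL₂) + THE BRUHAT WORD**: for `x ≠ 0`, `f(w₀ u(x) · (w₀ u(x′) y)) = T(x) · f(w₀ u(x′ + κ x⁻¹) y)` with `T(x) = C₀ ν(x)⁻¹ ‖x‖^{−e}`.
[cite: Casselman1980, §3 Thm. 3.1] [cite: CasselmanShalika1980, §2] -/
theorem apply_weyl_u_weyl_u_eq {f : G → ℂ} {u ū : w.adicCompletion K → G} (w₀ : G) (ν : (w.adicCompletion K)ˣ →* ℂˣ) (e C₀ : ℂ)
    (hrel : ∀ (x : (w.adicCompletion K)ˣ) (g : G),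
      f (w₀ * u x * g) = C₀ * (((ν x)⁻¹ : ℂˣ) : ℂ) * ((normAbs (w.adicCompletion K) (x : w.adicCompletion K) : ℝ) : ℂ) ^ (-e) *
        f (ū ((x⁻¹ : (w.adicCompletion K)ˣ) : w.adicCompletion K) * g))
    (κ : w.adicCompletion K) (hword : ∀ r x' : w.adicCompletion K, ū r * (w₀ * u x') = w₀ * u (x' + κ * r))
    (T : w.adicCompletion K → ℂ)
    (hT : ∀ x : (w.adicCompletion K)ˣ, T x = C₀ * (((ν x)⁻¹ : ℂˣ) : ℂ) * ((normAbs (w.adicCompletion K) (x : w.adicCompletion K) : ℝ) : ℂ) ^ (-e))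
    (x : (w.adicCompletion K)ˣ) (x' : w.adicCompletion K) (y : G) :
    f (w₀ * u x * (w₀ * u x' * y)) = T x * f (w₀ * u (x' + κ * ((x⁻¹ : (w.adicCompletion K)ˣ) : w.adicCompletion K)) * y) := by
  rw [hrel x, hT x, ← mul_assoc (ū _), hword]

/-- **THE TAIL OF THE (SL₂)-INTEGRAND in ★ B5b's units currency** (as inside ★ B3 `integrable_and_integral_eq`): off `𝔭^{−m₀}`,
`f(w₀ u(x) y) = (C₀ f(y))·ν(x)⁻¹·‖x‖^{−e}` (`ū(x⁻¹)` is absorbed by `K′`). [cite: Casselman1980, §3 Thm. 3.1] -/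
theorem apply_weyl_u_eq_tail {f : G → ℂ} {K' : Subgroup G} (hfK : ∀ g, ∀ k ∈ K', f (g * k) = f g)
    {u ū : w.adicCompletion K → G} (w₀ : G) (ν : (w.adicCompletion K)ˣ →* ℂˣ) (e C₀ : ℂ)
    (hrel : ∀ (x : (w.adicCompletion K)ˣ) (g : G),
      f (w₀ * u x * g) = C₀ * (((ν x)⁻¹ : ℂˣ) : ℂ) * ((normAbs (w.adicCompletion K) (x : w.adicCompletion K) : ℝ) : ℂ) ^ (-e) *
        f (ū ((x⁻¹ : (w.adicCompletion K)ˣ) : w.adicCompletion K) * g))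
    (y : G) (m₀ : ℕ) (hmū : ∀ t ∈ primePowBall (w.adicCompletion K) (m₀ : ℤ), y⁻¹ * ū t * y ∈ K') :
    ∀ x : (w.adicCompletion K)ˣ, (x : w.adicCompletion K) ∉ primePowBall (w.adicCompletion K) (-(m₀ : ℤ)) →
      f (w₀ * u x * y) = C₀ * f y * (((ν x)⁻¹ : ℂˣ) : ℂ) * ((normAbs (w.adicCompletion K) (x : w.adicCompletion K) : ℝ) : ℂ) ^ (-e) := by
  intro x hx
  have hxinv : ((x⁻¹ : (w.adicCompletion K)ˣ) : w.adicCompletion K) ∈ primePowBall (w.adicCompletion K) (m₀ : ℤ) := by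
    rw [mem_primePowBall_iff] at hx ⊢
    rw [not_le] at hx
    rw [Units.val_inv_eq_inv_val, map_inv₀]
    have hx0 : (0 : ℝ≥0) < normAbs (w.adicCompletion K) (x : w.adicCompletion K) := (zpow_pos inv_residueFieldCard_pos _).trans hx
    rw [inv_le_comm₀ hx0 (zpow_pos inv_residueFieldCard_pos _), ← zpow_neg]
    exact le_trans (inv_residueFieldCard_zpow_le_iff.2 (by omega)) hx.le
  have hk := hmū _ hxinv
  have h1 : ū ((x⁻¹ : (w.adicCompletion K)ˣ) : w.adicCompletion K) * y = y * (y⁻¹ * ū ((x⁻¹ : (w.adicCompletion K)ˣ) : w.adicCompletion K) * y) := by group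
  rw [hrel x y, h1, hfK _ _ hk]
  ring

variable [MeasurableSpace (w.adicCompletion K)] [BorelSpace (w.adicCompletion K)]
  (μ : Measure (w.adicCompletion K)) [μ.IsAddHaarMeasure]

/-- **THE TWISTED HEAD SUM OF A TRANSLATE**: with `Φ(z) := f(w₀ u(z) y)` of level `m₀` at `y`, a coset level `m ≥ m₀` past the head threshold (`ψ(σ·) ≡ 1` on `𝔭^m`),
representatives `R` of `𝔭^{−M} ⧸ 𝔭^m`, and the far-ball thresholds `M ≥ max(m₀, −j, c_ν − j − 1)` (`σ ∉ 𝔭^{c_ψ − j}`): for every shift `c`,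
`Σ_{a∈R} μ(𝔭^m) conj ψ(σa) Φ(a + c) = ψ(σc) · [c ∈ 𝔭^{−M}] · Σ_{a∈R} μ(𝔭^m) conj ψ(σa) Φ(a)` — the translate's head sum is the head integral of the translate, i.e.
`ψ(σc)` times the twisted integral over the shifted ball (§1), which is the head integral again (`c ∈ 𝔭^{−M}`) or a far ball (§2: zero).
[cite: Tate1950, §2.5] [cite: CasselmanShalika1980, §2] [cite: Casselman1980, §3 Thm. 3.1] -/
theorem twistedHeadSum_comp_add_eq {f : G → ℂ} {K' : Subgroup G} (hfK : ∀ g, ∀ k ∈ K', f (g * k) = f g)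
    {u ū : w.adicCompletion K → G} (hu_add : ∀ x t, u (x + t) = u x * u t) (w₀ : G)
    (ν : (w.adicCompletion K)ˣ →* ℂˣ) (e C₀ : ℂ)
    (hrel : ∀ (x : (w.adicCompletion K)ˣ) (g : G),
      f (w₀ * u x * g) = C₀ * (((ν x)⁻¹ : ℂˣ) : ℂ) * ((normAbs (w.adicCompletion K) (x : w.adicCompletion K) : ℝ) : ℂ) ^ (-e) *
        f (ū ((x⁻¹ : (w.adicCompletion K)ˣ) : w.adicCompletion K) * g))
    (cν : ℤ)
    (hνc : ∀ x : (w.adicCompletion K)ˣ, normAbs (w.adicCompletion K) (x : w.adicCompletion K) = 1 →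
      (x : w.adicCompletion K) - 1 ∈ primePowBall (w.adicCompletion K) cν → ν x = 1)
    (y : G) (m₀ : ℕ) (hmu : ∀ t ∈ primePowBall (w.adicCompletion K) (m₀ : ℤ), y⁻¹ * u t * y ∈ K')
    (hmū : ∀ t ∈ primePowBall (w.adicCompletion K) (m₀ : ℤ), y⁻¹ * ū t * y ∈ K')
    {ψ : AddChar (w.adicCompletion K) Circle} {cψ : ℤ} (hcψ : ψ.HasConductorExp cψ) {σ : w.adicCompletion K} {j : ℤ}
    (hσ : σ ∉ primePowBall (w.adicCompletion K) (cψ - j))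
    (m : ℕ) (hm : m₀ ≤ m) (hσm : ∀ t ∈ primePowBall (w.adicCompletion K) (m : ℤ), ψ (σ * t) = 1)
    {M : ℤ} (hm₀M : (m₀ : ℤ) ≤ M) (hjM : -M ≤ j) (hcM : cν - j - 1 ≤ M)
    (R : Finset (w.adicCompletion K))
    (hRinc : ∀ a ∈ R, ∀ a' ∈ R, a ≠ a' → a - a' ∉ primePowBall (w.adicCompletion K) (m : ℤ))
    (hRcov : primePowBall (w.adicCompletion K) (-M) = ⋃ a ∈ R, {x | x - a ∈ primePowBall (w.adicCompletion K) (m : ℤ)})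
    (c : w.adicCompletion K) :
    ∑ a ∈ R, (μ.real (primePowBall (w.adicCompletion K) (m : ℤ)) : ℂ) * (conj ((ψ (σ * a) : ℂ)) * f (w₀ * u (a + c) * y)) =
      ((ψ (σ * c) : ℂ)) * (primePowBall (w.adicCompletion K) (-M)).indicator (fun _ => (1 : ℂ)) c *
        ∑ a ∈ R, (μ.real (primePowBall (w.adicCompletion K) (m : ℤ)) : ℂ) * (conj ((ψ (σ * a) : ℂ)) * f (w₀ * u a * y)) := by
  -- `Φ(z + c)` and `Φ(z)` are locally constant modulo `𝔭^m` in `z` (level `m₀ ≤ m` at `y`, ★ `apply_mul_u_add`)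
  have hlev : ∀ (c' z : w.adicCompletion K), ∀ t ∈ primePowBall (w.adicCompletion K) (m : ℤ), f (w₀ * u (z + t + c') * y) = f (w₀ * u (z + c') * y) := by
    intro c' z t ht
    rw [show z + t + c' = (z + c') + t by ring]
    exact apply_mul_u_add hfK hu_add w₀ y (m := (m : ℤ)) (fun t ht => hmu t (primePowBall_antitone (by exact_mod_cast hm) ht)) (z + c') ht
  -- the head sums as head integrals (★ B5a), for the translate and for the original
  have hhead : ∀ c' : w.adicCompletion K,
      ∫ x in primePowBall (w.adicCompletion K) (-M), conj ((ψ (σ * x) : ℂ)) * f (w₀ * u (x + c') * y) ∂μ =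
        ∑ a ∈ R, (μ.real (primePowBall (w.adicCompletion K) (m : ℤ)) : ℂ) * (conj ((ψ (σ * a) : ℂ)) * f (w₀ * u (a + c') * y)) := by
    intro c'
    refine (integrableOn_and_setIntegral_head_eq_sum μ R hRinc hRcov (fun x => conj ((ψ (σ * x) : ℂ)) * f (w₀ * u (x + c') * y))
      (fun a _ x hx => ?_)).2
    have h := twisted_const_on_cosets hσm (fun z => f (w₀ * u (z + c') * y)) (fun z t ht => hlev c' z t ht) a hx
    beta_reduce at h
    rwa [add_sub_cancel] at h
  rw [← hhead c, setIntegral_primePowBall_twisted_comp_add μ ψ σ (fun x => f (w₀ * u x * y)) (-M) c]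
  by_cases hc : c ∈ primePowBall (w.adicCompletion K) (-M)
  · -- the shifted ball is the ball: head integral again
    rw [setOf_sub_mem_primePowBall_eq_of_mem hc, Set.indicator_of_mem hc, mul_one]
    congr 1
    have h0 := hhead 0
    simp only [add_zero] at h0
    exact h0
  · -- far ball: zero
    rw [Set.indicator_of_notMem hc, mul_zero, zero_mul]
    rw [setIntegral_farBall_twisted_eq_zero μ (fun x => f (w₀ * u x * y)) ν cν hνc (C₀ * f y) e (n := -(m₀ : ℤ))
      (apply_weyl_u_eq_tail hfK w₀ ν e C₀ hrel y m₀ hmū) hcψ hσ (by omega) hjM hcM hc, mul_zero]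

/-- **THE RANK-ONE ψ-WHITTAKER FUNCTIONAL EQUATION** (convergence half-plane, fixed truncation): in the letters of ★ B3 (`hfK hu_add w₀ ν e C₀ hrel`, levels `m₀` at `y`),
the Bruhat word (W) with its constant `κ` (`‖κ‖ = q^{−k_κ}`), the tail letter `T = C₀ ν(·)⁻¹‖·‖^{−e}`, the conductor letter `c_ν`, a coset level `m ≥ m₀` past the head
threshold, representatives `R` of `𝔭^{−M} ⧸ 𝔭^m` with `M ≥ max(m₀, −j, c_ν − j − 1)` (`σ ∉ 𝔭^{c_ψ − j}`), and the (★ B3) integrability of `x ↦ f(w₀ u(x) · w₀ u(a) y)`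
for `a ∈ R` (`1 < re e`):
  `Σ_{a∈R} μ(𝔭^m) conj ψ(σa) · ∫ f(w₀ u(x) · w₀ u(a) y) dμ(x) = (∫_{x ∉ 𝔭^{M+k_κ+1}} T(x) ψ(σκx⁻¹) dμ(x)) · Σ_{a∈R} μ(𝔭^m) conj ψ(σa) f(w₀ u(a) y)`
— the ψ_σ-twisted stage of the intertwined function `A_e f` is `Γ^M_σ(e)` times that of `f`. [cite: CasselmanShalika1980, §2, §4] [cite: Casselman1980, §3 Thm. 3.1]
[cite: KudlaRallis1994, §2] [cite: GanTakeda2011SiegelWeil, §7 Lemma 7.4] [cite: Tate1950, §2.5] -/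
theorem twistedHeadSum_intertwined_eq_mul {f : G → ℂ} {K' : Subgroup G} (hfK : ∀ g, ∀ k ∈ K', f (g * k) = f g)
    {u ū : w.adicCompletion K → G} (hu_add : ∀ x t, u (x + t) = u x * u t) (w₀ : G)
    (ν : (w.adicCompletion K)ˣ →* ℂˣ) (e C₀ : ℂ)
    (hrel : ∀ (x : (w.adicCompletion K)ˣ) (g : G),
      f (w₀ * u x * g) = C₀ * (((ν x)⁻¹ : ℂˣ) : ℂ) * ((normAbs (w.adicCompletion K) (x : w.adicCompletion K) : ℝ) : ℂ) ^ (-e) *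
        f (ū ((x⁻¹ : (w.adicCompletion K)ˣ) : w.adicCompletion K) * g))
    (κ : w.adicCompletion K) {kκ : ℤ} (hκ : normAbs (w.adicCompletion K) κ = (residueFieldCard (w.adicCompletion K) : ℝ≥0)⁻¹ ^ kκ)
    (hword : ∀ r x' : w.adicCompletion K, ū r * (w₀ * u x') = w₀ * u (x' + κ * r))
    (T : w.adicCompletion K → ℂ)
    (hT : ∀ x : (w.adicCompletion K)ˣ, T x = C₀ * (((ν x)⁻¹ : ℂˣ) : ℂ) * ((normAbs (w.adicCompletion K) (x : w.adicCompletion K) : ℝ) : ℂ) ^ (-e))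
    (cν : ℤ)
    (hνc : ∀ x : (w.adicCompletion K)ˣ, normAbs (w.adicCompletion K) (x : w.adicCompletion K) = 1 →
      (x : w.adicCompletion K) - 1 ∈ primePowBall (w.adicCompletion K) cν → ν x = 1)
    (y : G) (m₀ : ℕ) (hmu : ∀ t ∈ primePowBall (w.adicCompletion K) (m₀ : ℤ), y⁻¹ * u t * y ∈ K')
    (hmū : ∀ t ∈ primePowBall (w.adicCompletion K) (m₀ : ℤ), y⁻¹ * ū t * y ∈ K')
    {ψ : AddChar (w.adicCompletion K) Circle} {cψ : ℤ} (hcψ : ψ.HasConductorExp cψ) {σ : w.adicCompletion K} {j : ℤ}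
    (hσ : σ ∉ primePowBall (w.adicCompletion K) (cψ - j))
    (m : ℕ) (hm : m₀ ≤ m) (hσm : ∀ t ∈ primePowBall (w.adicCompletion K) (m : ℤ), ψ (σ * t) = 1)
    {M : ℤ} (hm₀M : (m₀ : ℤ) ≤ M) (hjM : -M ≤ j) (hcM : cν - j - 1 ≤ M)
    (R : Finset (w.adicCompletion K))
    (hRinc : ∀ a ∈ R, ∀ a' ∈ R, a ≠ a' → a - a' ∉ primePowBall (w.adicCompletion K) (m : ℤ))
    (hRcov : primePowBall (w.adicCompletion K) (-M) = ⋃ a ∈ R, {x | x - a ∈ primePowBall (w.adicCompletion K) (m : ℤ)})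
    (hintA : ∀ a ∈ R, Integrable (fun x => f (w₀ * u x * (w₀ * u a * y))) μ) :
    ∑ a ∈ R, (μ.real (primePowBall (w.adicCompletion K) (m : ℤ)) : ℂ) * (conj ((ψ (σ * a) : ℂ)) * ∫ x, f (w₀ * u x * (w₀ * u a * y)) ∂μ) =
      (∫ x in (primePowBall (w.adicCompletion K) (M + kκ + 1))ᶜ, T x * ((ψ (σ * (κ * x⁻¹)) : ℂ)) ∂μ) *
        ∑ a ∈ R, (μ.real (primePowBall (w.adicCompletion K) (m : ℤ)) : ℂ) * (conj ((ψ (σ * a) : ℂ)) * f (w₀ * u a * y)) := by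
  set W : ℂ := ∑ a ∈ R, (μ.real (primePowBall (w.adicCompletion K) (m : ℤ)) : ℂ) * (conj ((ψ (σ * a) : ℂ)) * f (w₀ * u a * y)) with hW
  -- Step 1: the finite sum of integrals is the integral of the finite sum
  have hswap : ∑ a ∈ R, (μ.real (primePowBall (w.adicCompletion K) (m : ℤ)) : ℂ) * (conj ((ψ (σ * a) : ℂ)) * ∫ x, f (w₀ * u x * (w₀ * u a * y)) ∂μ) =
      ∫ x, ∑ a ∈ R, (μ.real (primePowBall (w.adicCompletion K) (m : ℤ)) : ℂ) * (conj ((ψ (σ * a) : ℂ)) * f (w₀ * u x * (w₀ * u a * y))) ∂μ := by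
    rw [integral_finsetSum _ (fun a ha => ((hintA a ha).const_mul _).const_mul _)]
    refine Finset.sum_congr rfl fun a _ => ?_
    rw [← integral_const_mul, ← integral_const_mul]
  -- Step 2: the pointwise identity off `x = 0`
  have hpt : ∀ x : w.adicCompletion K, x ≠ 0 →
      ∑ a ∈ R, (μ.real (primePowBall (w.adicCompletion K) (m : ℤ)) : ℂ) * (conj ((ψ (σ * a) : ℂ)) * f (w₀ * u x * (w₀ * u a * y))) =
        (primePowBall (w.adicCompletion K) (M + kκ + 1))ᶜ.indicator (fun x => T x * ((ψ (σ * (κ * x⁻¹)) : ℂ))) x * W := by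
    intro x hx0
    set ξ : (w.adicCompletion K)ˣ := Units.mk0 x hx0 with hξ
    have hxξ : x = (ξ : w.adicCompletion K) := by rw [hξ, Units.val_mk0]
    -- (SL₂) + (W) inside each summand
    have h1 : ∀ a : w.adicCompletion K, f (w₀ * u x * (w₀ * u a * y)) =
        T x * f (w₀ * u (a + κ * ((ξ⁻¹ : (w.adicCompletion K)ˣ) : w.adicCompletion K)) * y) := by
      intro a
      rw [hxξ]
      exact apply_weyl_u_weyl_u_eq w₀ ν e C₀ hrel κ hword T hT ξ a y
    simp_rw [h1]
    have h2 : ∑ a ∈ R, (μ.real (primePowBall (w.adicCompletion K) (m : ℤ)) : ℂ) *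
          (conj ((ψ (σ * a) : ℂ)) * (T x * f (w₀ * u (a + κ * ((ξ⁻¹ : (w.adicCompletion K)ˣ) : w.adicCompletion K)) * y))) =
        T x * ∑ a ∈ R, (μ.real (primePowBall (w.adicCompletion K) (m : ℤ)) : ℂ) *
          (conj ((ψ (σ * a) : ℂ)) * f (w₀ * u (a + κ * ((ξ⁻¹ : (w.adicCompletion K)ˣ) : w.adicCompletion K)) * y)) := by
      rw [Finset.mul_sum]
      refine Finset.sum_congr rfl fun a _ => by ring
    rw [h2, twistedHeadSum_comp_add_eq μ hfK hu_add w₀ ν e C₀ hrel cν hνc y m₀ hmu hmū hcψ hσ m hm hσm hm₀M hjM hcM R hRinc hRcov, ← hW]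
    -- the region: `κ x⁻¹ ∈ 𝔭^{−M} ↔ x ∉ 𝔭^{M + k_κ + 1}`
    have hreg : κ * ((ξ⁻¹ : (w.adicCompletion K)ˣ) : w.adicCompletion K) ∈ primePowBall (w.adicCompletion K) (-M) ↔
        x ∉ primePowBall (w.adicCompletion K) (M + kκ + 1) := by
      rw [mem_primePowBall_iff, mem_primePowBall_iff, map_mul, hκ, Units.val_inv_eq_inv_val, map_inv₀, ← hxξ, not_le]
      obtain ⟨k, hk⟩ := exists_normAbs_eq_inv_zpow hx0
      rw [hk, ← zpow_neg, ← zpow_add₀ inv_residueFieldCard_pos.ne', inv_residueFieldCard_zpow_le_iff,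
        ← not_le, inv_residueFieldCard_zpow_le_iff, not_le]
      omega
    have hinvξ : ((ξ⁻¹ : (w.adicCompletion K)ˣ) : w.adicCompletion K) = x⁻¹ := by rw [Units.val_inv_eq_inv_val, ← hxξ]
    by_cases hxr : x ∈ primePowBall (w.adicCompletion K) (M + kκ + 1)
    · have hc : κ * ((ξ⁻¹ : (w.adicCompletion K)ˣ) : w.adicCompletion K) ∉ primePowBall (w.adicCompletion K) (-M) := fun h => (hreg.1 h) hxr
      rw [Set.indicator_of_notMem hc, Set.indicator_of_notMem (fun h => (Set.mem_compl_iff _ _).1 h hxr)]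
      ring
    · have hc : κ * ((ξ⁻¹ : (w.adicCompletion K)ˣ) : w.adicCompletion K) ∈ primePowBall (w.adicCompletion K) (-M) := hreg.2 hxr
      rw [Set.indicator_of_mem hc, Set.indicator_of_mem (show x ∈ (primePowBall (w.adicCompletion K) (M + kκ + 1))ᶜ from hxr), hinvξ]
      ring
  -- Step 3: integrate (the point `x = 0` is `μ`-null)
  have hae : ∀ᵐ x ∂μ, ∑ a ∈ R, (μ.real (primePowBall (w.adicCompletion K) (m : ℤ)) : ℂ) * (conj ((ψ (σ * a) : ℂ)) * f (w₀ * u x * (w₀ * u a * y))) =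
      (primePowBall (w.adicCompletion K) (M + kκ + 1))ᶜ.indicator (fun x => T x * ((ψ (σ * (κ * x⁻¹)) : ℂ))) x * W := by
    have h0 : ∀ᵐ x ∂μ, x ≠ (0 : w.adicCompletion K) := by
      rw [ae_iff]
      simp only [ne_eq, not_not, Set.setOf_eq_eq_singleton]
      exact measure_singleton_zero μ
    filter_upwards [h0] with x hx using hpt x hx
  rw [hswap, integral_congr_ae hae, integral_mul_const, integral_indicator (measurableSet_primePowBall _).compl]

end Datum

end Summit.HodgeConjecture.HodgeConjecture.Cruxes.HLiu418.K2LiuRankOneWhittakerFunctionalEquation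

end
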